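import Literature.Analysis.FluidPDE.NSVorticity
import Literature.Analysis.FluidPDE.LerayHopf
import HarnessLib

/-!
# Interpolation between the `½`-Hölder direction criterion and the Beale–Kato–Majda-type
# `L^q` vorticity criteria (Grujić–Ruzmaikina 2004, Theorem 4.1)

Topic `Analysis/FluidPDE`. Source: Z. Grujić, A. Ruzmaikina, *Interpolation between algebraic
and geometric conditions for smoothness of the vorticity in the 3D NSE*, Indiana Univ. Math. J.
**53** (2004) 1073–1080 [GrujicRuzmaikina2004] (held, lit key
`paper:doi-10-1512-iumj-2004-53-2415`; §2 (2.1)–(2.4) p. 1074, §3 (Constantin's representation,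
`Ω_t(M)`, Theorems 3.1–3.2) pp. 1075–1076, **Theorem 4.1** with Remarks 4.2–4.5 pp. 1076–1079
read).

This is the GLOBAL (whole space, uniform in time) hybrid geometric–analytic family that
Grujić–Zhang 2006 later localized (`grujicZhang2006_localized_hybrid_coherence`,
`GrujicZhang2006LocalizedDirectionCriteria.lean`): a `1/q`-Hölder-type coherence of the vorticity
direction off the high-vorticity set, compensated by the time-integrability
`‖ω(t)‖_{L^q}^{q/(q−1)} ∈ L¹(0, T)` of the vorticity magnitude, controls `‖ω(t)‖_{L^q}` up to
`t = T`; `q = 2` is the purely geometric end-point (Beirão da Veiga–Berselli 2002, in the tree the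
PROVED `holderHalf_direction_criterion`; the Lipschitz case is the PROVED `constantin_fefferman`),
`q = ∞` the Beale–Kato–Majda end-point. The paper's Theorems 3.1 (Constantin–Fefferman) and 3.2
(Beirão da Veiga–Berselli) are restatements of those tree theorems and are NOT re-vendored. The
neighbouring PROVED tree criteria with a small Hölder exponent compensated by integrability sit at
other points of the same scaling line `2/r + 3/p = 2 + s`: `holder_direction_vorticityLp_criterion`
(`ω ∈ L²(0,T; L^{3/(s+1)})`, Beirão da Veiga 2002 / Chae 2007 (1.10)) and
`holder_direction_vorticityLqL2_criterion` (`ω ∈ L^{4/(2s+1)}(0,T; L²)`, Beirão da Veiga 2019);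
Theorem 4.1 (`ω ∈ L^{q/(q−1)}(0,T; L^q)`, `s = 1/q`) is not among them and not implied by them
(`lean search 'Ruzmaikina|GrujicRuzmaikina|hybrid_direction'`, 2026-08-26: docstring mentions only).

No regularity claim about Navier–Stokes is made by this file beyond the printed theorem, recorded
as a named fact (`def … : Prop`, cite-tagged, unproved here).

## What is printed (pp. 1074–1076, verbatim up to notation)

(2.1) `ω_t − νΔω + (u·∇)ω = (ω·∇)u` on `ℝ³`; `ξ = ω/|ω|`; (3.2)–(3.3) Constantin's representation
`α(x) = (3/4π) P.V. ∫ D(ŷ, ξ(x+y), ξ(x)) |ω(x+y)| dy/|y|³`, "denoting the angle between `ξ(x + y)`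
and `ξ(x)` by `φ`, it is easy to see that `|D| ≤ |sin φ| ≤ |ξ(x + y) − ξ(x)|`"; "For `M > 0`,
`t > 0`, denote by `Ω_t(M)` the super-level sets `Ω_t(M) = {x ∈ Ω : |ω(x, t)| ≥ M}`."

**Theorem 4.1.** "Let `u₀ ∈ L²`, `div u₀ = 0`, `ω₀ = curl u₀ ∈ L¹ ∩ L^q` for some `q ≥ 2`, and
assume that there exist absolute constants `c` and `M` such that a solution `ω` satisfies
(i) `‖ω‖_q^{q/(q−1)} ∈ L¹(0, T)`,
(ii) `|sin φ(ξ(x + y), ξ(x))| ≤ c|y|^{1/q}` for all `x ∈ Ω_t(M)`, `t ∈ (0, T)`.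
Then `lim_{t↑T} ‖ω(t)‖_q < ∞`."
**Remark 4.2.** "The case `q = 2` recovers Theorem 3.2, and the limit case `q = ∞` recovers the
space-time limit condition (2.4)." **Remark 4.3.** "We present formal a priori estimates. A rigorous
proof is easily obtained by the standard continuation argument." **Remark 4.5.** "(i) `M` can be
time-dependent; in particular, we can take `M ∼ ‖ω‖_∞^{1/2}` (up to a logarithmic correction).
(ii) The Hölder regularity condition on `ξ` needs to hold only locally."

## Transcription into the tree's vocabulary (frame of `constantin_fefferman`, ns.S27)

* `ℝ³ = EuclideanSpace ℝ (Fin 3)`, time first, viscosity `ν > 0` (the paper keeps `ν` in (2.1),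
  (4.1)). "a solution" for which the a-priori estimates of §4 are legitimate (Remark 4.3): a
  classical unforced solution `(u, p)` on `ℝ³ × [0, T)` (`IsClassicalNSSolutionOn (Ico 0 T) ν 0 u p`)
  in the Beale–Kato–Majda class on every compact `[0, T''] ⊆ [0, T)` (`HasBoundedSobolevNormsOn`),
  exactly as the tree's `constantin_fefferman` / `holderHalf_direction_criterion`; the datum
  hypotheses `u₀ ∈ L²`, `div u₀ = 0`, `ω₀ ∈ L^q` are then automatic, and `ω₀ ∈ L¹` (used on p. 1078
  for Constantin's a-priori bound on `‖ω(t)‖₁` [4]) is kept: `Integrable (curl (u 0))`.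
* (i): `t ↦ ‖curl (u t)‖_{L^q}` lies in `L^{q/(q−1)}(0, T)`, i.e. the tree's mixed class
  `MemLqLp (q/(q−1)) q (fun t x => curl (u t) x) (Ioo 0 T)`.
* (ii) is rendered SIGN-BLINDLY: `|sin φ(ξ(x+y), ξ(x))| = ‖ξ(x+y,t) × ξ(x,t)‖ ≤ c‖y‖^{1/q}` for ALL
  `y` and all `x` with `|ω(x,t)| ≥ M` (one-sided threshold, as printed; where `ω(x+y,t) = 0` the
  tree's junk direction `0` makes the condition vacuous, matching the vanishing of the integrand
  `D |ω(x+y)|` of `α`), `ξ = vorticityDirection (curl (u t))`.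
* Conclusion "`lim_{t↑T} ‖ω(t)‖_q < ∞`": the `L^q` norm of the vorticity stays bounded on a left
  neighbourhood of `T`: `∃ C T₁, T₁ < T ∧ ∀ t ∈ (T₁, T) ∩ [0, T), ‖curl (u t)‖_{L^q} ≤ C`
  (`eLpNorm`, `ℝ≥0∞`-valued). The continuation past `T` that the paper alludes to (Remark 4.3) is
  not part of the printed conclusion and is not recorded; for `q = 2` it is the tree's
  `hasSobolevExtensionPast_of_uniform_H1_bound` route.
* `q` is a real number `≥ 2` (the "limit case `q = ∞`", Beale–Kato–Majda, is not a case of the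
  theorem).

## References

* Z. Grujić, A. Ruzmaikina, Indiana Univ. Math. J. 53 (2004) 1073–1080,
  doi:10.1512/iumj.2004.53.2415: (2.1)–(2.4) (p. 1074), §3 (pp. 1075–1076), Thm. 4.1 and Remarks
  4.2–4.5 (pp. 1076–1079). [GrujicRuzmaikina2004]
* H. Beirão da Veiga, L. C. Berselli, Differential Integral Equations 15 (2002) 345–356 (the case
  `q = 2`; tree theorem `holderHalf_direction_criterion`). [BeiraodaveigaBerselli2002]
* P. Constantin, C. Fefferman, Indiana Univ. Math. J. 42 (1993) 775–789 (tree theorem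
  `constantin_fefferman`). [ConstantinFeffermanIndiana1993]
* Z. Grujić, Q. S. Zhang, Comm. Math. Phys. 262 (2006) 555–564 (the localization; tree fact
  `grujicZhang2006_localized_hybrid_coherence`). [GrujicZhang2006]
-/

noncomputable section

open MeasureTheory Set Function Filter Metric
open scoped ENNReal

namespace Literature.Analysis.FluidPDE

/-- **Grujić–Ruzmaikina 2004, Theorem 4.1 (hybrid geometric–analytic control of `‖ω‖_{L^q}`).**
Let `ν > 0`, `T > 0`, `q ≥ 2`, and let `(u, p)` be a classical unforced Navier–Stokes solution on
`ℝ³ × [0, T)` in the Beale–Kato–Majda class on every `[0, T'']`, `T'' < T`, with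
`curl (u 0) ∈ L¹(ℝ³)`. Assume, for constants `c` and `M`,
(i) `∫₀ᵀ ‖ω(t)‖_{L^q}^{q/(q−1)} dt < ∞` (`ω = curl u`), and
(ii) `|sin φ(ξ(x+y,t), ξ(x,t))| = ‖ξ(x+y,t) × ξ(x,t)‖ ≤ c|y|^{1/q}` for all `t ∈ (0, T)`, all `x`
with `|ω(x,t)| ≥ M` and all `y` (`ξ = ω/|ω| = vorticityDirection`).
Then `lim_{t↑T} ‖ω(t)‖_{L^q} < ∞`: the `L^q` norm of the vorticity stays bounded on a left
neighbourhood of `T`. The case `q = 2` is Beirão da Veiga–Berselli's `½`-Hölder criterion (tree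
theorem `holderHalf_direction_criterion`, two-sided threshold, conclusion = continuation). Not
proved here; users take `(h : grujicRuzmaikina2004_hybrid_direction_criterion)`.
[cite: GrujicRuzmaikina2004, Thm. 4.1 (p. 1076) with §3 p. 1076 (`Ω_t(M)`, `sin φ`) and Remarks 4.2–4.3] -/
def grujicRuzmaikina2004_hybrid_direction_criterion : Prop :=
  ∀ ⦃ν T q : ℝ⦄, 0 < ν → 0 < T → 2 ≤ q →
    ∀ ⦃u : ℝ → EuclideanSpace ℝ (Fin 3) → EuclideanSpace ℝ (Fin 3)⦄
      ⦃p : ℝ → EuclideanSpace ℝ (Fin 3) → ℝ⦄,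
    IsClassicalNSSolutionOn (Ico 0 T) ν 0 u p →
    (∀ T'' < T, HasBoundedSobolevNormsOn (Icc 0 T'') u) →
    Integrable (curl (u 0)) →
    -- (i) `‖ω(t)‖_{L^q}^{q/(q-1)} ∈ L¹(0, T)`
    MemLqLp (ENNReal.ofReal (q / (q - 1))) (ENNReal.ofReal q) (fun t x => curl (u t) x) (Ioo 0 T) →
    -- (ii) `1/q`-Hölder-type (sign-blind) coherence off the high-vorticity set `{|ω(·,t)| ≥ M}`
    (∃ c M : ℝ, ∀ t ∈ Ioo 0 T, ∀ x : EuclideanSpace ℝ (Fin 3), M ≤ ‖curl (u t) x‖ →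
      ∀ y : EuclideanSpace ℝ (Fin 3),
        ‖cross (vorticityDirection (curl (u t)) (x + y)) (vorticityDirection (curl (u t)) x)‖ ≤
          c * ‖y‖ ^ (1 / q)) →
    -- `lim_{t ↑ T} ‖ω(t)‖_{L^q} < ∞`
    ∃ (C : ℝ) (T₁ : ℝ), T₁ < T ∧ ∀ t ∈ Ioo T₁ T, 0 ≤ t →
      eLpNorm (curl (u t)) (ENNReal.ofReal q) volume ≤ ENNReal.ofReal C

end Literature.Analysis.FluidPDE

end
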